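import Literature.AlgebraicGeometry.Resolution.DiffIdealBlowupAlgebra
import Literature.AlgebraicGeometry.Resolution.DiffOpLocalization
import Literature.AlgebraicGeometry.Resolution.DiffOpUnramifiedUnique
import HarnessLib

/-!
# Giraud's lemma with exceptional shift for `Diff^{≤ n}` on the local rings of a blow-up chart

Topic: `Literature/AlgebraicGeometry/Resolution`. Companion of `DiffIdealBlowupAlgebra.lean` (Giraud's lemma for
Grothendieck differential operators of order `≤ n` on the affine blowup algebra `S = R[I/a] ⊆ L = R[1/a]`, key
estimate `IsDiffOpLE.pow_mul_apply_div_mem`: `aⁿ · D̃(y/aᵉ) ∈ aᵗ · S` for `y ∈ I^{e+t}`). Here the estimate is turned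
into the OPERATOR form with an arbitrary **exceptional shift** `N` and pushed to every LOCALIZATION `O′` of the chart
(the local rings `𝒪_{X′,x′}` of a blowing up are such localizations, `BlowupStalkCharts.lean`):

* `blowupAlgebra.exists_isDiffOpLE_shift` — for `a ∈ I`, `D ∈ Diff^{≤n}_{R/k}` and every `N`: differential operators
  `E`, `Δ` of order `≤ n` of `S = R[I/a]` with `E(r) = aⁿ · D(r)` on `R` (the extension of `aⁿ D`, Giraud's lemma) and
  **`a^N · Δ(s) = E(a^N · s)`** for all `s ∈ S` (the shift: `Δ = a^{n−N} D̃ (a^N ·)` restricted to `S`, pole-free by the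
  key estimate with `t = N`);
* `exists_isDiffOpLE_shift_of_isLocalization_blowupAlgebra` — **the shift law on any localization `O′ = M⁻¹S`**: for every
  `D ∈ Diff^{≤n}_{R/k}` and every `N` there is `Δ ∈ Diff^{≤n}_{O′/k}` with
  `aⁿ · φ(D h) = a^N · Δ(w)` whenever `φ(h) = a^N · w` (`h ∈ R`, `w ∈ O′`, `φ : R → O′` the structure map). The operators
  of `S` are localized (`diffOpLocalize`, `DiffOpLocalization.lean`) and the identity `a^N • Δ′ = E′ ∘ (a^N ·)` is
  transported by UNIQUENESS of differential operators along the formally unramified `S → O′`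
  (`IsDiffOpLE.eq_of_apply_algebraMap_eq`, `DiffOpUnramifiedUnique.lean`);
* `exists_isDiffOpLE_shift_of_mem_span` — the law for one generator `u` of a principal ideal of `O′` implies the law for
  any other generator `z` of the same ideal (`z = ε u`, `u = ε′ z`; no unit or regularity hypothesis).

Motivation (cell `res-hironaka`, campaign D-0089, row R34 / Th. 7.12 of the manuscript under adjudication; nothing of
the manuscript is asserted here): this is the ring-level content of the hypothesis shape «(HG) Giraud shift law»
named by the adjudication of that row; the stalk-level statement over a blowing up `IsBlowup π J` is assembled in
`DiffOpBlowupStalkShift.lean`.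

## Sources

* A. Bravo, M. L. García-Escamilla, O. Villamayor U., *Finite morphisms and simultaneous reduction of the
  multiplicity*, arXiv:1107.1797, Lemma 4.6 (Giraud's Lemma) p. 15. [BravoGarciaEscamillaVillamayor2012]
* A. Grothendieck, J. Dieudonné, EGA IV₄ (Publ. Math. IHÉS 32, 1967), (16.8.1), Prop. (16.8.8), Prop. (17.2.1)
  (restriction/extension of differential operators, commutator criterion, formally unramified algebras). [EGAIV4]
-/

noncomputable section

open IsLocalization

namespace Literature.AlgebraicGeometry.Resolution

universe u v w

/-! ## The shifted Giraud operators on the chart `R[I/a]` -/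

section Chart

variable (k : Type u) [CommRing k] {R : Type v} [CommRing R] [Algebra k R] {I : Ideal R} {a : R}

/-- **Giraud's lemma with exceptional shift on `R[I/a]`.** For `a ∈ I`, a `k`-linear differential operator `D` of
order `≤ n` of `R` and any `N : ℕ`, there are differential operators `E`, `Δ` of order `≤ n` of `S = R[I/a]` with
`E(r) = aⁿ · D(r)` for `r ∈ R` (`E` is the restriction of `aⁿ D̃`, `D̃` an extension of `D` to `R[1/a]`) and
`a^N · Δ(s) = E(a^N · s)` for every `s ∈ S` (`Δ` is the restriction of `a^{n−N} D̃ (a^N ·)`; both preserve `S` by the key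
estimate `aⁿ D̃(y/aᵉ) ∈ aᵗ S`, `y ∈ I^{e+t}`, with `t = 0` and `t = N`).
[cite: BravoGarciaEscamillaVillamayor2012, Lemma 4.6 p.15 (Giraud's Lemma), here for Diff^{≤ n} via EGA IV₄ 16.8.8 (b) and with the exceptional shift a^N] -/
theorem blowupAlgebra.exists_isDiffOpLE_shift (ha : a ∈ I) (n N : ℕ) {D : R →ₗ[k] R}
    (hD : IsDiffOpLE k n D) :
    ∃ (E Δ : blowupAlgebra I a →ₗ[k] blowupAlgebra I a),
      IsDiffOpLE k n E ∧ IsDiffOpLE k n Δ ∧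
      (∀ r : R, E (algebraMap R (blowupAlgebra I a) r) = algebraMap R (blowupAlgebra I a) (a ^ n * D r)) ∧
      ∀ s : blowupAlgebra I a,
        algebraMap R (blowupAlgebra I a) a ^ N * Δ s = E (algebraMap R (blowupAlgebra I a) a ^ N * s) := by
  obtain ⟨D', hD', hext⟩ := exists_isDiffOpLE_extend k a (B := Localization.Away a) hD
  -- `E₀ = aⁿ • D̃` and `Δ₀ = (1/a)^N • E₀ ∘ (a^N ·)` on `L = R[1/a]`
  set aL : Localization.Away a := algebraMap R (Localization.Away a) a with haL
  set E₀ : Localization.Away a →ₗ[k] Localization.Away a := (aL ^ n) • D' with hE₀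
  have hE₀' : IsDiffOpLE k n E₀ := hD'.smul _
  have hE₀_apply : ∀ x, E₀ x = aL ^ n * D' x := fun x => rfl
  set u : Localization.Away a := Away.invSelf a ^ N with hu
  set Δ₀ : Localization.Away a →ₗ[k] Localization.Away a :=
    u • (E₀ ∘ₗ LinearMap.mulLeft k (aL ^ N)) with hΔ₀
  have hΔ₀' : IsDiffOpLE k n Δ₀ := by
    have := (hE₀'.comp (isDiffOpLE_mulLeft (aL ^ N))).smul u
    rwa [add_zero] at this
  have hΔ₀_apply : ∀ x, Δ₀ x = u * (aL ^ n * D' (aL ^ N * x)) := fun x => rfl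
  have hau : aL ^ N * u = 1 := by rw [hu, ← mul_pow, haL, Away.mul_invSelf, one_pow]
  -- `E₀` preserves `S` (key estimate with `t = 0`)
  have hEmem : ∀ s ∈ blowupAlgebra I a, E₀ s ∈ blowupAlgebra I a := by
    intro s hs
    obtain ⟨e, y, hy, rfl⟩ := blowupAlgebra.exists_eq_mul_invSelf_pow I a ha hs
    have hy' : y ∈ I ^ (e + 0) := by rwa [add_zero]
    obtain ⟨s', hs', hs'_eq⟩ := hD.pow_mul_apply_div_mem k hD' hext e 0 hy'
    rw [hE₀_apply, haL, hs'_eq, pow_zero, one_mul]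
    exact hs'
  -- `Δ₀` preserves `S` (key estimate with `t = N`)
  have hΔmem : ∀ s ∈ blowupAlgebra I a, Δ₀ s ∈ blowupAlgebra I a := by
    intro s hs
    obtain ⟨e, y, hy, rfl⟩ := blowupAlgebra.exists_eq_mul_invSelf_pow I a ha hs
    have hy' : a ^ N * y ∈ I ^ (e + N) := by
      rw [add_comm, pow_add]; exact Ideal.mul_mem_mul (Ideal.pow_mem_pow ha N) hy
    obtain ⟨s', hs', hs'_eq⟩ := hD.pow_mul_apply_div_mem k hD' hext e N hy'
    rw [(algebraMap R (Localization.Away a)).map_mul, (algebraMap R (Localization.Away a)).map_pow,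
      mul_assoc] at hs'_eq
    rw [hΔ₀_apply, haL, hs'_eq, ← mul_assoc, mul_comm u, ← haL, hau, one_mul]
    exact hs'
  -- restrict both operators to `S`
  let E : blowupAlgebra I a →ₗ[k] blowupAlgebra I a :=
    { toFun := fun s => ⟨E₀ s, hEmem s s.2⟩
      map_add' := fun s s' => Subtype.ext (by simp)
      map_smul' := fun c s => Subtype.ext (by simp) }
  let Δ : blowupAlgebra I a →ₗ[k] blowupAlgebra I a :=
    { toFun := fun s => ⟨Δ₀ s, hΔmem s s.2⟩
      map_add' := fun s s' => Subtype.ext (by simp)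
      map_smul' := fun c s => Subtype.ext (by simp) }
  refine ⟨E, Δ, IsDiffOpLE.of_val_eq k (blowupAlgebra I a) hE₀' (fun s => rfl),
    IsDiffOpLE.of_val_eq k (blowupAlgebra I a) hΔ₀' (fun s => rfl), fun r => ?_, fun s => ?_⟩
  · apply Subtype.ext
    change E₀ (algebraMap R (Localization.Away a) r) = algebraMap R (Localization.Away a) (a ^ n * D r)
    rw [hE₀_apply, hext, map_mul, map_pow]
  · apply Subtype.ext
    change algebraMap R (Localization.Away a) a ^ N * Δ₀ s = E₀ (algebraMap R (Localization.Away a) a ^ N * s)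
    rw [hΔ₀_apply, ← haL, ← mul_assoc, hau, one_mul, hE₀_apply]

end Chart

/-! ## The shift law on the localizations of the chart -/

section Localize

variable (k : Type u) [CommRing k] {R : Type v} [CommRing R] [Algebra k R] {I : Ideal R} {a : R}
variable {O' : Type w} [CommRing O'] [Algebra k O'] [Algebra (blowupAlgebra I a) O']
  [IsScalarTower k (blowupAlgebra I a) O']

/-- **Giraud's shift law on a localization of `R[I/a]`.** Let `a ∈ I ⊆ R`, `S = R[I/a]`, and `O′ = M⁻¹S` any
localization of `S` (as `k`-algebras over `S`), `φ : R → S → O′` the structure map. For every `k`-linear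
differential operator `D` of order `≤ n` of `R` and every `N : ℕ` there is a `k`-linear differential operator `Δ` of
order `≤ n` of `O′` such that **`φ(a)ⁿ · φ(D h) = φ(a)^N · Δ(w)` whenever `φ(h) = φ(a)^N · w`** (`h ∈ R`, `w ∈ O′`).
Proof: localize the chart operators `E`, `Δ` of `blowupAlgebra.exists_isDiffOpLE_shift` to `O′`; the identity
`φ(a)^N • Δ′ = E′ ∘ (φ(a)^N ·)` holds on the image of `S`, hence on `O′` because `S → O′` is formally unramified and both
sides have order `≤ n`; then `φ(a)^N Δ′(w) = E′(φ h) = φ(aⁿ D h)`.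
[cite: BravoGarciaEscamillaVillamayor2012, Lemma 4.6 p.15 (Giraud's Lemma), localized via EGA IV₄ (16.8.1), (16.8.8), (17.2.1)] -/
theorem exists_isDiffOpLE_shift_of_isLocalization_blowupAlgebra (M : Submonoid (blowupAlgebra I a))
    [IsLocalization M O'] (ha : a ∈ I) (n N : ℕ) {D : R →ₗ[k] R} (hD : IsDiffOpLE k n D) :
    ∃ Δ : O' →ₗ[k] O', IsDiffOpLE k n Δ ∧
      ∀ (h : R) (w : O'),
        algebraMap (blowupAlgebra I a) O' (algebraMap R (blowupAlgebra I a) h) =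
            algebraMap (blowupAlgebra I a) O' (algebraMap R (blowupAlgebra I a) a) ^ N * w →
        algebraMap (blowupAlgebra I a) O' (algebraMap R (blowupAlgebra I a) a) ^ n *
            algebraMap (blowupAlgebra I a) O' (algebraMap R (blowupAlgebra I a) (D h)) =
          algebraMap (blowupAlgebra I a) O' (algebraMap R (blowupAlgebra I a) a) ^ N * Δ w := by
  obtain ⟨E, Δ, hE, hΔ, hEext, hshift⟩ := blowupAlgebra.exists_isDiffOpLE_shift k ha n N hD
  -- localize `E` and `Δ`
  have hEo : IsDiffOpOver k n (algebraLinearMap k (blowupAlgebra I a) O' ∘ₗ E) := hE.isDiffOpOver_comp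
  have hΔo : IsDiffOpOver k n (algebraLinearMap k (blowupAlgebra I a) O' ∘ₗ Δ) := hΔ.isDiffOpOver_comp
  have hE' : IsDiffOpLE k n (diffOpLocalize k O' M hEo) := isDiffOpLE_diffOpLocalize k O' M hEo
  have hΔ' : IsDiffOpLE k n (diffOpLocalize k O' M hΔo) := isDiffOpLE_diffOpLocalize k O' M hΔo
  have hE'_alg : ∀ s, diffOpLocalize k O' M hEo (algebraMap (blowupAlgebra I a) O' s) =
      algebraMap (blowupAlgebra I a) O' (E s) := fun s => by
    rw [diffOpLocalize_algebraMap]; rfl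
  have hΔ'_alg : ∀ s, diffOpLocalize k O' M hΔo (algebraMap (blowupAlgebra I a) O' s) =
      algebraMap (blowupAlgebra I a) O' (Δ s) := fun s => by
    rw [diffOpLocalize_algebraMap]; rfl
  set aO : O' := algebraMap (blowupAlgebra I a) O' (algebraMap R (blowupAlgebra I a) a) with haO
  -- the operator identity `aO^N • Δ' = E' ∘ (aO^N ·)`, by uniqueness along the formally unramified `S → O'`
  haveI : Algebra.FormallyUnramified (blowupAlgebra I a) O' := Algebra.FormallyUnramified.of_isLocalization M
  have key : (aO ^ N) • diffOpLocalize k O' M hΔo =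
      diffOpLocalize k O' M hEo ∘ₗ LinearMap.mulLeft k (aO ^ N) := by
    refine IsDiffOpLE.eq_of_apply_algebraMap_eq k (A := blowupAlgebra I a) (hΔ'.smul _) ?_ fun s => ?_
    · have := hE'.comp (isDiffOpLE_mulLeft (aO ^ N)); rwa [add_zero] at this
    · simp only [LinearMap.smul_apply, LinearMap.comp_apply, LinearMap.mulLeft_apply, smul_eq_mul]
      rw [hΔ'_alg, haO, ← map_pow, ← map_mul, hshift, ← hE'_alg, map_mul, map_pow]
  refine ⟨diffOpLocalize k O' M hΔo, hΔ', fun h w hw => ?_⟩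
  have hkey := LinearMap.congr_fun key w
  simp only [LinearMap.smul_apply, LinearMap.comp_apply, LinearMap.mulLeft_apply, smul_eq_mul] at hkey
  rw [hkey, ← hw, hE'_alg, hEext, map_mul, map_pow, map_mul, map_pow]

end Localize

/-! ## Change of the exceptional generator -/

section Generator

variable {k : Type u} {k' : Type v} [CommRing k] [CommRing k'] {O : Type w} {O' : Type*} [CommRing O]
  [CommRing O'] [Algebra k O] [Algebra k' O'] (φ : O →+* O')

/-- **The shift law does not depend on the generator of the exceptional ideal.** If the shift law holds along
`φ : O → O′` for the element `u ∈ O′` (for all orders `n` and shifts `N`), and `z = ε u`, `u = ε′ z` (two generators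
of the same principal ideal), then it holds for `z`: `Δ_z = εⁿ ε′^N • Δ_u ∘ (ε^N ·)`. No unit, regularity or base
hypothesis is used.
[cite: BravoGarciaEscamillaVillamayor2012, Lemma 4.6 p.15 (Giraud's Lemma: the statement depends only on the exceptional ideal I(H), not on its generator)] -/
theorem exists_isDiffOpLE_shift_of_mem_span {u z ε ε' : O'} (hz : z = ε * u) (hu : u = ε' * z)
    (H : ∀ (n N : ℕ) (D : O →ₗ[k] O), IsDiffOpLE k n D →
      ∃ Δ : O' →ₗ[k'] O', IsDiffOpLE k' n Δ ∧
        ∀ (h : O) (w : O'), φ h = u ^ N * w → u ^ n * φ (D h) = u ^ N * Δ w)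
    (n N : ℕ) (D : O →ₗ[k] O) (hD : IsDiffOpLE k n D) :
    ∃ Δ : O' →ₗ[k'] O', IsDiffOpLE k' n Δ ∧
      ∀ (h : O) (w : O'), φ h = z ^ N * w → z ^ n * φ (D h) = z ^ N * Δ w := by
  obtain ⟨Δ, hΔ, hlaw⟩ := H n N D hD
  refine ⟨(ε ^ n * ε' ^ N) • (Δ ∘ₗ LinearMap.mulLeft k' (ε ^ N)), ?_, fun h w hw => ?_⟩
  · have := (hΔ.comp (isDiffOpLE_mulLeft (ε ^ N))).smul (ε ^ n * ε' ^ N); rwa [add_zero] at this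
  · have hw' : φ h = u ^ N * (ε ^ N * w) := by rw [hw, hz, mul_pow]; ring
    have h1 := hlaw h (ε ^ N * w) hw'
    simp only [LinearMap.smul_apply, LinearMap.comp_apply, LinearMap.mulLeft_apply, smul_eq_mul]
    calc z ^ n * φ (D h) = ε ^ n * (u ^ n * φ (D h)) := by rw [hz, mul_pow]; ring
      _ = ε ^ n * (u ^ N * Δ (ε ^ N * w)) := by rw [h1]
      _ = ε ^ n * ((ε' * z) ^ N * Δ (ε ^ N * w)) := by rw [← hu]
      _ = z ^ N * (ε ^ n * ε' ^ N * Δ (ε ^ N * w)) := by rw [mul_pow]; ring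

end Generator

end Literature.AlgebraicGeometry.Resolution

end
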